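import Literature.NumberTheory.Automorphic.GodementJacquetZetaIntegrals   -- ★ `adelicAbsDet`
import Literature.NumberTheory.Automorphic.QuadraticHermitianNormTorusTwistGL   -- ★ p811639 `UnitaryGroup.det_torusTwist` (B-p04 (g24))
import Literature.NumberTheory.Automorphic.AddCharConductorExponent   -- ★ `normAbs_eq_inv_zpow_of_valued_eq`
import Literature.NumberTheory.Automorphic.AdicCompletionResidueCard   -- ★ `residueFieldCard_adicCompletion_eq`
import Literature.NumberTheory.GaloisRepresentations.HeckeCharacter   -- ★ `localUnits`, `finiteAdeleSingle_apply_of_ne`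
import HarnessLib

/-!
# The adelic module `|det g|_𝔸` of a matrix whose determinant is a ONE-PLACE idele: `|det|_𝔸 = |·|_v`

Topic `NumberTheory/Automorphic`; namespaces `Literature.NumberTheory.Automorphic` (§1, generic) and
`Literature.NumberTheory.Automorphic.UnitaryGroup` (§2, the torus twist).  KERNEL mathematics only (theorems; no `def`, no named fact, no
instance, no `sorry`).  [WeilBNT1967, Ch. IV §4]: the module of an idele is the product of the local modules, so an idele supported at one
finite place `v` has module `|x|_v`; [Weil1964, Chap. I n° 13 p. 160]: the module of the Levi element `d₀(α)` is `|det α|`.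

* §1 `adelicAbsDet_eq_ideleNorm_pow_of_det_eq` — if `det g = w^k` for an idele `w`, then `|det g|_𝔸 = ‖w‖^k` (`adelicAbsDet` is the idele
  norm of `GL.det`, a monoid hom); `ideleNorm_localUnits_eq_normAbs` — `‖(…, 1, x, 1, …)‖ = |x|_v`, the normalised absolute value `normAbs`
  of the local field `F_v` (Mathlib's norm on `F_v` IS `normAbs`, ★ `GlobalHeckeTheoryGL2OfCenterInvariant.norm_eq_coe_normAbs`, reproduced
  privately to keep the import closure free of the `GL₂` theory); `adelicAbsDet_eq_normAbs_pow_of_det_eq_localUnits` — both combined.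
* §2 `adelicAbsDet_torusTwist_inv_eq_ideleNorm_pow` ∕ `adelicAbsDet_torusTwist_inv_eq_normAbs_pow` — for the torus twist
  `Mt⁻¹ = M(p₂′, q₂′) = reindex (fromBlocks (p₂′•1) (q₂′•𝕋) ((d q₂′)•𝕋⁻¹) (p₂′•1))` of ★ `exists_torusTwistGL` (B-p04 (g24)), whose determinant is
  `(p₂′² − d q₂′²)ⁿ = N(V′)ⁿ` (★ `det_torusTwist`): if the norm `p₂′² − d q₂′²` is the one-place idele `(…, 1, s, 1, …)` at `v`, then
  **`adelicAbsDet (n+n) F Mt⁻¹ = (normAbs F_v s)ⁿ`** — item (η) of the (S-1) glue spec `F0/P4/S1-GLUE-SPEC.hbd_CM_of_letters` (F0P4-p05 (g2)),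
  cell `hodgecm-mathlib`, FLOOR-0 P4, ENGINE E-2, I-CLOSE, binder `hLD` of ★ `E2SWDilateBoundCM.hbd_CM` through (γ) ★
  `l2Scaling_eq_of_omega_eq_twistLM`.  HC_CM is proved only modulo the printed citations until rung 0 closes.

## References
* [WeilBNT1967] A. Weil, *Basic Number Theory* (1967), Ch. IV §4 (the module of an idele; product over places).
* [Weil1964] A. Weil, *Sur certains groupes d'opérateurs unitaires*, Acta Math. 111 (1964), Chap. I n° 13 p. 160.
* [TateThesis1967] J. Tate, *Fourier analysis in number fields …*, in Cassels–Fröhlich (1967), §4.3 (`|𝔞| = ∏ |𝔞_𝔭|_𝔭`).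
-/

set_option autoImplicit false

noncomputable section

open scoped NNReal MatrixGroups
open NumberField IsDedekindDomain
open Literature.NumberTheory.GaloisRepresentations (ideleGroup localUnits localUnits_fst localUnits_snd_apply_self
  finiteAdeleSingle_apply_of_ne)
open Literature.NumberTheory.GaloisRepresentations.IsNonarchimedeanLocalField

namespace Literature.NumberTheory.Automorphic

variable (F : Type) [Field F] [NumberField F]

/-! ### §1 `|det g|_𝔸` when `det g` is a power of an idele; one-place ideles -/

/-- **`|det g|_𝔸 = ‖w‖ᵏ` if `det g = wᵏ`** for an idele `w` (`adelicAbsDet = ideleNorm ∘ GL.det`, both monoid homs; units of `𝔸_F` with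
equal values are equal). [cite: WeilBNT1967, Ch. IV §4] -/
theorem adelicAbsDet_eq_ideleNorm_pow_of_det_eq {m : ℕ} (g : GL (Fin m) (AdeleRing (𝓞 F) F)) (w : ideleGroup F) (k : ℕ)
    (h : (g : Matrix (Fin m) (Fin m) (AdeleRing (𝓞 F) F)).det = ((w : AdeleRing (𝓞 F) F)) ^ k) :
    adelicAbsDet m F g = IdeleClassGroup.ideleNorm F w ^ k := by
  rw [adelicAbsDet_apply, ← map_pow]
  congr 1
  ext
  rw [Matrix.GeneralLinearGroup.val_det_apply, h, Units.val_pow_eq_pow_val]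

/-- Mathlib's norm on `F_v` is the normalised absolute value `normAbs` (both are `q_v^{-v(x)}`; ★
`GlobalHeckeTheoryGL2OfCenterInvariant.norm_eq_coe_normAbs`, reproduced to keep the import closure small). [folklore] -/
private theorem norm_eq_coe_normAbs' (v : HeightOneSpectrum (𝓞 F)) (x : v.adicCompletion F) :
    ‖x‖ = ((normAbs (v.adicCompletion F) x : ℝ≥0) : ℝ) := by
  by_cases hx : x = 0
  · rw [hx, norm_zero, map_zero, NNReal.coe_zero]
  have hv : Valued.v x ≠ 0 := (Valuation.ne_zero_iff _).2 hx
  have hxn : Valued.v x = WithZero.exp (Multiplicative.toAdd (WithZero.unzero hv)) := by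
    rw [WithZero.exp, ofAdd_toAdd, WithZero.coe_unzero]
  rw [FinitePlace.norm_def, WithZeroMulInt.toNNReal_neg_apply _ hv,
    normAbs_eq_inv_zpow_of_valued_eq v hxn, residueFieldCard_adicCompletion_eq, inv_zpow', neg_neg]
  rfl

/-- **The idele norm of a ONE-PLACE idele is the local normalised absolute value**: `‖(…, 1, x, 1, …)‖ = |x|_v` (every other local
factor is `‖1‖ = 1`; ★ `MeanSquareLowerGL2.ideleNorm_localUnits` gives the `‖·‖₊` spelling).
[cite: TateThesis1967, §4.3] [cite: WeilBNT1967, Ch. IV §4] -/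
theorem ideleNorm_localUnits_eq_normAbs (v : HeightOneSpectrum (𝓞 F)) (x : (v.adicCompletion F)ˣ) :
    IdeleClassGroup.ideleNorm F (localUnits v x) = normAbs (v.adicCompletion F) (x : v.adicCompletion F) := by
  rw [ideleNorm_apply]
  have h1 : (∏ w : InfinitePlace F, ‖((localUnits v x : ideleGroup F) : AdeleRing (𝓞 F) F).1 w‖₊ ^ w.mult) = 1 := by
    refine Finset.prod_eq_one fun w _ => ?_
    rw [localUnits_fst]
    change ‖(1 : w.Completion)‖₊ ^ w.mult = 1
    rw [nnnorm_one, one_pow]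
  rw [h1, one_mul, finprod_eq_single _ v]
  · rw [localUnits_snd_apply_self]
    exact NNReal.eq (by rw [coe_nnnorm, norm_eq_coe_normAbs'])
  · intro w hwv
    change ‖(Literature.NumberTheory.GaloisRepresentations.finiteAdeleSingle v (x : v.adicCompletion F)) w‖₊ = 1
    rw [finiteAdeleSingle_apply_of_ne _ hwv, nnnorm_one]

/-- **`|det g|_𝔸 = |s|_vᵏ`** if `det g` is the `k`-th power of the one-place idele `(…, 1, s, 1, …)` at the finite place `v`.
[cite: WeilBNT1967, Ch. IV §4] -/
theorem adelicAbsDet_eq_normAbs_pow_of_det_eq_localUnits {m : ℕ} (g : GL (Fin m) (AdeleRing (𝓞 F) F))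
    (v : HeightOneSpectrum (𝓞 F)) (x : (v.adicCompletion F)ˣ) (k : ℕ)
    (h : (g : Matrix (Fin m) (Fin m) (AdeleRing (𝓞 F) F)).det = ((localUnits v x : ideleGroup F) : AdeleRing (𝓞 F) F) ^ k) :
    adelicAbsDet m F g = normAbs (v.adicCompletion F) (x : v.adicCompletion F) ^ k := by
  rw [adelicAbsDet_eq_ideleNorm_pow_of_det_eq F g (localUnits v x) k h, ideleNorm_localUnits_eq_normAbs]

/-! ### §2 The torus twist: `|det M(p₂′, q₂′)|_𝔸 = ‖N(V′)‖ⁿ`, and `= |s|_vⁿ` for a one-place norm -/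

namespace UnitaryGroup

variable {F}

/-- **`|det Mt⁻¹|_𝔸 = ‖w‖ⁿ` for the torus twist** `↑Mt⁻¹ = M(p₂′, q₂′)` whenever the norm `N(V′) = p₂′² − d q₂′²` is (the value of) an
idele `w` — ★ `det_torusTwist`: `det M(p₂′, q₂′) = N(V′)ⁿ`. [cite: Weil1964, Chap. I n° 13 p. 160] [cite: WeilBNT1967, Ch. IV §4] -/
theorem adelicAbsDet_torusTwist_inv_eq_ideleNorm_pow {n : ℕ} (𝕋 : Matrix (Fin n) (Fin n) (AdeleRing (𝓞 F) F)) (h𝕋 : IsUnit 𝕋.det)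
    {d p₂' q₂' : AdeleRing (𝓞 F) F} (Mt : GL (Fin (n + n)) (AdeleRing (𝓞 F) F))
    (hMt : ((Mt⁻¹ : GL (Fin (n + n)) (AdeleRing (𝓞 F) F)) : Matrix (Fin (n + n)) (Fin (n + n)) (AdeleRing (𝓞 F) F)) =
      Matrix.reindex finSumFinEquiv finSumFinEquiv
        (Matrix.fromBlocks (p₂' • (1 : Matrix (Fin n) (Fin n) (AdeleRing (𝓞 F) F))) (q₂' • 𝕋) ((d * q₂') • 𝕋⁻¹) (p₂' • 1)))
    (w : ideleGroup F) (hw : (w : AdeleRing (𝓞 F) F) = p₂' * p₂' - d * (q₂' * q₂')) :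
    adelicAbsDet (n + n) F Mt⁻¹ = IdeleClassGroup.ideleNorm F w ^ n :=
  adelicAbsDet_eq_ideleNorm_pow_of_det_eq F Mt⁻¹ w n (by rw [hMt, det_torusTwist 𝕋 h𝕋 d p₂' q₂', hw])

/-- **(η) `adelicAbsDet (n+n) F Mt⁻¹ = (normAbs F_v s)ⁿ`** — the norm evaluation of the (S-1) glue: for the torus twist `↑Mt⁻¹ = M(p₂′, q₂′)`
(★ `exists_torusTwistGL`) whose norm `p₂′² − d q₂′²` is the ONE-PLACE idele `(…, 1, s, 1, …)` at the finite place `v` (`s ∈ F_vˣ`; the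
(ζ) letter: `N_{E∕F}((c̄ t)⁻¹)` for a one-place torus idele `t`), the adelic module of `Mt⁻¹` is `|s|_vⁿ`.
[cite: Weil1964, Chap. I n° 13 p. 160] [cite: WeilBNT1967, Ch. IV §4] -/
theorem adelicAbsDet_torusTwist_inv_eq_normAbs_pow {n : ℕ} (𝕋 : Matrix (Fin n) (Fin n) (AdeleRing (𝓞 F) F)) (h𝕋 : IsUnit 𝕋.det)
    {d p₂' q₂' : AdeleRing (𝓞 F) F} (Mt : GL (Fin (n + n)) (AdeleRing (𝓞 F) F))
    (hMt : ((Mt⁻¹ : GL (Fin (n + n)) (AdeleRing (𝓞 F) F)) : Matrix (Fin (n + n)) (Fin (n + n)) (AdeleRing (𝓞 F) F)) =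
      Matrix.reindex finSumFinEquiv finSumFinEquiv
        (Matrix.fromBlocks (p₂' • (1 : Matrix (Fin n) (Fin n) (AdeleRing (𝓞 F) F))) (q₂' • 𝕋) ((d * q₂') • 𝕋⁻¹) (p₂' • 1)))
    (v : HeightOneSpectrum (𝓞 F)) (s : (v.adicCompletion F)ˣ)
    (hs : ((localUnits v s : ideleGroup F) : AdeleRing (𝓞 F) F) = p₂' * p₂' - d * (q₂' * q₂')) :
    adelicAbsDet (n + n) F Mt⁻¹ = normAbs (v.adicCompletion F) (s : v.adicCompletion F) ^ n := by
  rw [adelicAbsDet_torusTwist_inv_eq_ideleNorm_pow 𝕋 h𝕋 Mt hMt (localUnits v s) hs, ideleNorm_localUnits_eq_normAbs]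

/-- the same with the scalar as a non-zero element `s : F_v` (`Units.mk0`), the spelling `(normAbs F_v s : ℝ≥0) ^ n` of the `hLD` letter of ★
`E2SWDilateBoundCM.hbd_CM`. [cite: Weil1964, Chap. I n° 13 p. 160] [cite: WeilBNT1967, Ch. IV §4] -/
theorem adelicAbsDet_torusTwist_inv_eq_normAbs_pow' {n : ℕ} (𝕋 : Matrix (Fin n) (Fin n) (AdeleRing (𝓞 F) F)) (h𝕋 : IsUnit 𝕋.det)
    {d p₂' q₂' : AdeleRing (𝓞 F) F} (Mt : GL (Fin (n + n)) (AdeleRing (𝓞 F) F))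
    (hMt : ((Mt⁻¹ : GL (Fin (n + n)) (AdeleRing (𝓞 F) F)) : Matrix (Fin (n + n)) (Fin (n + n)) (AdeleRing (𝓞 F) F)) =
      Matrix.reindex finSumFinEquiv finSumFinEquiv
        (Matrix.fromBlocks (p₂' • (1 : Matrix (Fin n) (Fin n) (AdeleRing (𝓞 F) F))) (q₂' • 𝕋) ((d * q₂') • 𝕋⁻¹) (p₂' • 1)))
    (v : HeightOneSpectrum (𝓞 F)) {s : v.adicCompletion F} (hs0 : s ≠ 0)
    (hs : ((localUnits v (Units.mk0 s hs0) : ideleGroup F) : AdeleRing (𝓞 F) F) = p₂' * p₂' - d * (q₂' * q₂')) :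
    adelicAbsDet (n + n) F Mt⁻¹ = normAbs (v.adicCompletion F) s ^ n :=
  adelicAbsDet_torusTwist_inv_eq_normAbs_pow 𝕋 h𝕋 Mt hMt v (Units.mk0 s hs0) hs

end UnitaryGroup

end Literature.NumberTheory.Automorphic

end
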